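import Literature.NumberTheory.IwasawaTheory.Fukuda1994Thm1RankProofs
import Literature.NumberTheory.IwasawaTheory.ClassGroupPRankCoinvariantCriterion
import Literature.NumberTheory.IwasawaTheory.ClassicalLambdaInvariant
import Literature.NumberTheory.IwasawaTheory.NarrowFukudaRankMonotone
import Literature.NumberTheory.IwasawaTheory.ClassicalMuVanishesBoundedRankProofs
import Literature.NumberTheory.IwasawaTheory.ZpExtensionTotallyRamifiedFrom
import HarnessLib

/-!
# `λ ≤ r`: the classical Iwasawa `λ`-invariant is bounded by any eventual bound on the `p`-ranks of the layers — in particular by the value of a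
# Fukuda RANK certificate (`rank_p Cl(K_{n+1}) = rank_p Cl(K_n) = r ⟹ λ ≤ r`) — at finite level, through Fukuda's method

Topic `NumberTheory/IwasawaTheory` (namespace = path).  THEOREM-ONLY file (no definition, no named fact, no instance, no `sorry`), written by the prover seat
`bsd-line-att-p3` g28 (cell `bsd-f1-sign2`; `--supports` stmt-BirchSwinnertonDyer-22298; closes nothing; no class group is computed here).  Sequel of the
cell bsd-potss files `FukudaRankGrowthSteps` / `Fukuda1994Thm1RankProofs` (Fukuda 1994 Thm. 1 (2) at finite level, PROVED) and `ClassicalMuVanishesIffBoundedRank`.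

THE STATEMENT.  `κ : K_∞/K` a `ℤ_p`-extension of a number field with Fukuda index `n₀` (`TotallyRamifiedFrom κ n₀`), `e_m = ord_p h(K_m)`, `r_m = rank_p Cl(K_m)`.
* `classNumberPExp_succ_le_add_of_classGroupPRank_le` — the GROWTH STEP read as a bound on ONE difference: if `r_{n+k+1} ≤ r ≤ p^{k₀}` with `n ≥ n₀`, `k ≥ k₀ + 1`,
  then **`e_{n+k+1} ≤ e_{n+k} + r`** (finite level: `e_{n+k+1} − e_{n+k} = log_p [ν_k Y₀ : p·ν_k Y₀] = rank_p (ν_k Y₀) ≤ rank_p A_{n+k+1}`).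
* ★ `classicalLambda_le_of_forall_classGroupPRank_le` — if `r_m ≤ B` for all `m ≥ n` (`n ≥ n₀`) then `μ = 0` (tree: bounded ranks) and **`classicalLambda κ ≤ B`**
  (`e_{m+1} − e_m ≤ B` for `m ≥ n + B + 1`, and under `μ = 0` that difference is eventually `λ`).
* ★ `classicalLambda_le_of_classGroupPRank_succ_eq` — **a Fukuda rank certificate bounds `λ`: `r_{n+1} = r_n` (`n ≥ n₀`) ⟹ `classicalLambda κ ≤ r_n`**
  (the certificate freezes the rank, Fukuda Thm. 1 (2)); `classicalLambda_le_of_coinvariant_index_le` — the coinvariant door (L12) with parameter `c` gives `λ ≤ c`.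
* ★ `exists_forall_classicalLambda_le_classGroupPRank` (§4, appended) — **`λ ≤ rank_p Cl(K_m)` for all `m ≫ 0`, for EVERY `ℤ_p`-extension of every number field**
  (no hypothesis: under `μ = 0` the ranks are bounded and non-decreasing above Fukuda's index, so they stabilise and the certificate bound applies; when `μ ≠ 0`
  `classicalLambda` is the junk value `0`); `classicalLambda_le_classGroupPRank_of_forall_le` (`μ = 0`, ranks `≤ B` ⟹ `λ ≤ r_m` for every `m ≥ n₀ + B`).

WHY (structure theory, for orientation only — NOT used): under `μ = 0`, `X = Gal(L_∞/K_∞) ≅ ℤ_p^λ ⊕ (finite)` and `rank_p A_m = dim X/pX ≥ λ` for `m ≫ 0`.  The proof here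
is the finite shadow already in the tree: in the package `G = Gal(H_p(K_{n+k+1})/K_n)` (`Fukuda1994Thm1RankPackage`), unipotence of `γ` mod `p` on an `𝔽_p`-space of
dimension `≤ r ≤ p^{k₀}` gives `ν_{k+1} Y₀ = p·ν_k Y₀` for `k ≥ k₀ + 1` (`FukudaNakayama.map_geom_sum_eq_map_smul`), and `#(Y/pY) = #Y[p] ≤ #A[p] = #(A/pA)`.
Not found in print in this finite form (presearch: corpus Lang 1990 Ch. 5 §1, Washington §13.3; galaxy none); the ingredients are Washington's Lemma 13.18 /
Prop. 13.22–13.23 and Fukuda's method, cited at each use (D-0014: our proof of a statement assembled from cited ingredients).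

References: [Fukuda1994] T. Fukuda, *Remarks on ℤ_p-extensions of number fields*, Proc. Japan Acad. 70 A (1994), Thm. 1 (2) and proof, p. 264; [Washington1997]
§13.3 Lemmas 13.15–13.18, Prop. 13.22–13.23, Thm. 13.13; [Lang1990] Ch. 5 §1 Thm. 1.2, Ch. 13 §2.
-/

set_option autoImplicit false

noncomputable section

open Subgroup Finset
open scoped NumberField IsMulCommutative

/-! ## §1 Algebra: `#W ≤ #(pW) · #(M/pM)` for a subgroup `W` of a finite abelian group `M` -/

namespace Literature.NumberTheory.IwasawaTheory.FukudaNakayama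

/-- **`#W ≤ #(pW) · #(M/pM)`** for a subgroup `W ≤ M` of a finite abelian group: `#W = #(pW)·#(W/pW)` and `#(W/pW) = #W[p] ≤ #M[p] = #(M/pM)` (the `p`-rank of a
subgroup is at most that of the group).  Here `pW = W.map (p·1)` as a subgroup of `M`. [folklore] [cite: Washington1997, §13.3 (proof of Prop. 13.23)] -/
theorem card_le_card_map_smul_mul_card_quotient {M : Type*} [AddCommGroup M] [Finite M] (p : ℕ) (W : Submodule ℤ M) :
    Nat.card W ≤ Nat.card (W.map ((p : ℤ) • (1 : Module.End ℤ M))) * Nat.card (M ⧸ LinearMap.range ((p : ℤ) • (1 : Module.End ℤ M))) := by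
  classical
  set π : Module.End ℤ M := (p : ℤ) • 1 with hπ
  set πW : Module.End ℤ W := (p : ℤ) • 1 with hπW
  -- `#W = #(W / range πW) · #(range πW)`
  have h1 := Submodule.card_eq_card_quotient_mul_card (LinearMap.range πW)
  -- `range πW ≃ W.map π` (both are `{p • w : w ∈ W}`)
  have h2 : Nat.card (LinearMap.range πW) = Nat.card (W.map π) := by
    let f : LinearMap.range πW → W.map π := fun x => ⟨((x : W) : M), by
      obtain ⟨w, hw⟩ := LinearMap.mem_range.mp x.2
      refine Submodule.mem_map.mpr ⟨(w : M), w.2, ?_⟩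
      have := congrArg (fun y : W => (y : M)) hw
      simpa [hπW, hπ] using this⟩
    have hf : Function.Bijective f := by
      constructor
      · intro x y h
        apply Subtype.ext; apply Subtype.ext
        exact congrArg (fun z : W.map π => (z : M)) h
      · rintro ⟨y, hy⟩
        obtain ⟨w, hw, rfl⟩ := Submodule.mem_map.mp hy
        refine ⟨⟨πW ⟨w, hw⟩, LinearMap.mem_range_self _ _⟩, Subtype.ext ?_⟩
        simp [f, hπW, hπ]
    exact Nat.card_eq_of_bijective f hf
  have h3 : Nat.card (W ⧸ LinearMap.range πW) ≤ Nat.card (M ⧸ LinearMap.range π) := card_quotient_range_smul_le p W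
  rw [h1, h2]
  exact Nat.mul_le_mul_left _ h3

end Literature.NumberTheory.IwasawaTheory.FukudaNakayama

/-! ## §2 The group-theoretic brick: `[G_{k+1} : N_{k+1}] ≤ [G_k : N_k] · #(A/pA)` -/

namespace Literature.NumberTheory.IwasawaTheory.FukudaGroup

variable {G : Type*} [Group G] {A : Subgroup G} [A.Normal] [IsMulCommutative A] [Finite G] {p : ℕ} [hp : Fact p.Prime]
  {g : G} {𝓘 : Set (Subgroup G)} {t : ℕ}

omit [A.Normal] [IsMulCommutative A] [Finite G] hp in
/-- `∑_{i<mn} φ^i = (∑_{j<n} (φ^m)^j)·(∑_{i<m} φ^i)` (re-proved: the version of `FukudaRankGrowthSteps` is private).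
[cite: Washington1997, §13.3 Lemma 13.18 (`ν_{n+1} = ν_n · (1 + γ^{p^n} + ⋯)`)] -/
private theorem geom_sum_mul_eq' {M : Type*} [AddCommGroup M] (φ : Module.End ℤ M) (m n : ℕ) :
    ∑ i ∈ range (m * n), φ ^ i = (∑ j ∈ range n, (φ ^ m) ^ j) * ∑ i ∈ range m, φ ^ i := by
  have h : ∑ i ∈ range (m * n), (Polynomial.X : Polynomial ℤ) ^ i =
      (∑ j ∈ range n, ((Polynomial.X : Polynomial ℤ) ^ m) ^ j) * ∑ i ∈ range m, (Polynomial.X : Polynomial ℤ) ^ i := by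
    induction n with
    | zero => simp
    | succ n ih =>
      rw [Nat.mul_succ, Finset.sum_range_add, ih, Finset.sum_range_succ, add_mul]
      congr 1
      rw [Finset.mul_sum]
      exact Finset.sum_congr rfl fun i _ => by ring
  have h2 := congrArg (Polynomial.aeval φ) h
  simp only [map_sum, map_mul, map_pow, Polynomial.aeval_X] at h2
  exact h2

omit [A.Normal] [IsMulCommutative A] [Finite G] hp in
/-- A `φ`-stable submodule is stable under `φ^n`. [folklore] -/
private theorem pow_apply_mem'' {M : Type*} [AddCommGroup M] (φ : Module.End ℤ M) (W : Submodule ℤ M) (hW : ∀ w ∈ W, φ w ∈ W)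
    (n : ℕ) {w : M} (hw : w ∈ W) : (φ ^ n) w ∈ W := by
  induction n generalizing w with
  | zero => simpa using hw
  | succ n ih => rw [pow_succ, Module.End.mul_apply]; exact ih (hW w hw)

/-- **GROWTH STEP AS A ONE-DIFFERENCE BOUND.**  In the setting of `FukudaGroupLayers` (`G` finite, `A ◁ G` abelian of `p`-power order, `A⟨g⟩ = G`, `⟨g⟩ ∩ A = 1`,
`[G : A] = p^t`, inertia family `𝓘`), with `#(A/pA) ≤ p^r`, `r ≤ p^{k₀}`, `k ≥ k₀ + 1` and `k + 1 ≤ t`: for layers `G_k ⊇ G_{k+1} ⊇ A` of indices `p^k`, `p^{k+1}`,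
**`[G_{k+1} : N_{k+1}] ≤ [G_k : N_k] · p^r`** (`= e_{n+k+1} ≤ e_{n+k} + r` in the application).  PROOF: `Y = ν_k Y₀` has `(φ^{p^k} − 1)Y ⊆ p²Y` (unipotence mod `p`,
`FukudaNakayama.sub_one_apply_mem_map_of_card_le` at `k₀`, lifted one level and to `k`), so `ν_{k+1} Y₀ = (1 + φ^{p^k} + ⋯)Y = pY` (`map_geom_sum_eq_map_smul`); with
`[G_k : N_k]·#Y = #A = [G_{k+1} : N_{k+1}]·#(pY)` and `#Y ≤ #(pY)·#(A/pA)` (§1). [cite: Fukuda1994, Thm. 1 (2), p. 264 (proof)]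
[cite: Washington1997, §13.3 Lemma 13.18 and Prop. 13.23 (proof)] -/
theorem relIndex_layer_succ_le_mul_pow (hgA : Subgroup.zpowers g ⊓ A = ⊥) (hgen : A ⊔ Subgroup.zpowers g = ⊤)
    (hind : A.index = p ^ t) (h𝓘 : ∀ I ∈ 𝓘, I ⊓ A = ⊥ ∧ (I = ⊥ ∨ I ⊔ A = ⊤)) (hg𝓘 : Subgroup.zpowers g ∈ 𝓘)
    (hA : ∃ a : ℕ, Nat.card A = p ^ a) {r k₀ k : ℕ}
    (hr : Nat.card (Additive A ⧸ (⊤ : Submodule ℤ (Additive A)).map ((p : ℤ) • (1 : Module.End ℤ (Additive A)))) ≤ p ^ r)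
    (hk₀ : r ≤ p ^ k₀) (hk : k₀ + 1 ≤ k) (hkt : k + 1 ≤ t)
    {Gk : Subgroup G} (hAGk : A ≤ Gk) (hGk : Gk.index = p ^ k)
    {Gk1 : Subgroup G} (hAGk1 : A ≤ Gk1) (hGk1 : Gk1.index = p ^ (k + 1)) :
    (⁅Gk1, Gk1⁆ ⊔ ⨆ I ∈ 𝓘, I ⊓ Gk1).relIndex Gk1 ≤ (⁅Gk, Gk⁆ ⊔ ⨆ I ∈ 𝓘, I ⊓ Gk).relIndex Gk * p ^ r := by
  classical
  set φ : Module.End ℤ (Additive A) := conjEnd A g with hφ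
  set Y₀ : Submodule ℤ (Additive A) := subOf A (⁅(⊤ : Subgroup G), ⊤⁆ ⊔ ⨆ I ∈ 𝓘, I) with hY₀
  set π : Module.End ℤ (Additive A) := (p : ℤ) • (1 : Module.End ℤ (Additive A)) with hπ
  have hπapp : ∀ x, π x = (p : ℤ) • x := fun x => by rw [hπ, LinearMap.smul_apply, Module.End.one_apply]
  have hkt' : k ≤ t := by omega
  have hφt : φ ^ p ^ t = 1 := conjEnd_pow_index_eq_one hgA hgen hind
  have hM : ∃ a : ℕ, Nat.card (Additive A) = p ^ a := hA
  -- `Y = ν_k Y₀`, `φ`-stable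
  set Y : Submodule ℤ (Additive A) := Y₀.map (∑ i ∈ range (p ^ k), φ ^ i) with hY
  have hYstab : ∀ y ∈ Y, φ y ∈ Y := fun y hy => conjEnd_mem_map_subOf_commutator_sup hgA hgen hind h𝓘 hg𝓘 k hy
  -- index formulas: `R_k · #Y = #A`, `R_{k+1} · #Y_{k+1} = #A`
  have hIk := relIndex_commutator_sup_layer_mul_card hgA hgen hind h𝓘 hg𝓘 hkt' hAGk hGk
  have hIk1 := relIndex_commutator_sup_layer_mul_card hgA hgen hind h𝓘 hg𝓘 hkt hAGk1 hGk1
  rw [← hφ, ← hY₀] at hIk hIk1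
  rw [← hY] at hIk
  -- `ν_{k+1} = Φ_k ∘ ν_k` with `Φ_k = ∑_{i<p} (φ^{p^k})^i`
  have hνk1 : (∑ i ∈ range (p ^ (k + 1)), φ ^ i) = (∑ i ∈ range p, (φ ^ p ^ k) ^ i) * ∑ i ∈ range (p ^ k), φ ^ i := by
    rw [pow_succ]; exact geom_sum_mul_eq' φ (p ^ k) p
  have hYk1 : Y₀.map (∑ i ∈ range (p ^ (k + 1)), φ ^ i) = Y.map (∑ i ∈ range p, (φ ^ p ^ k) ^ i) := by
    rw [hνk1, Module.End.mul_eq_comp, Submodule.map_comp]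
  -- ### unipotence: `(φ^{p^{k₀}} - 1) Y ⊆ pY`, hence `(φ^{p^k} - 1) Y ⊆ p²Y`
  have hr' : Nat.card (Additive A ⧸ LinearMap.range ((p : ℤ) • (1 : Module.End ℤ (Additive A)))) ≤ p ^ r := by
    rw [← Submodule.map_top]; exact hr
  have hu₀ : ∀ y ∈ Y, (φ ^ (p ^ k₀) - 1) y ∈ Y.map π :=
    FukudaNakayama.sub_one_apply_mem_map_of_card_le hM φ hφt hr' hk₀ Y hYstab
  have hu₁ : ∀ y ∈ Y, (φ ^ (p ^ (k₀ + 1)) - 1) y ∈ (Y.map π).map π :=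
    FukudaNakayama.sub_one_apply_mem_map_map_of φ Y hYstab hu₀
  have huk : ∀ y ∈ Y, (φ ^ (p ^ k) - 1) y ∈ (Y.map π).map π := by
    obtain ⟨d, hd⟩ := Nat.exists_eq_add_of_le hk
    have hpow : φ ^ (p ^ k) = (φ ^ (p ^ (k₀ + 1))) ^ (p ^ d) := by rw [← pow_mul, ← pow_add, hd]
    rw [hpow]
    exact FukudaNakayama.pow_sub_one_apply_mem _ Y _ (fun y hy => pow_apply_mem'' φ Y hYstab _ hy) hu₁ _
  -- ### `Y_{k+1} = Φ_k Y = pY`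
  have hΦk : Y.map (∑ i ∈ range p, (φ ^ p ^ k) ^ i) = Y.map π :=
    FukudaNakayama.map_geom_sum_eq_map_smul hM (φ ^ p ^ k) Y (fun y hy => pow_apply_mem'' φ Y hYstab _ hy) huk
  rw [hYk1, hΦk] at hIk1
  -- ### counting: `R_{k+1} · #(pY) = R_k · #Y ≤ R_k · #(pY) · p^r`
  have hYle : Nat.card Y ≤ Nat.card ↥(Y.map π) * p ^ r :=
    (FukudaNakayama.card_le_card_map_smul_mul_card_quotient p Y).trans (Nat.mul_le_mul_left _ hr')
  have hpYpos : 0 < Nat.card ↥(Y.map π) := Nat.card_pos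
  apply Nat.le_of_mul_le_mul_right _ hpYpos
  calc (⁅Gk1, Gk1⁆ ⊔ ⨆ I ∈ 𝓘, I ⊓ Gk1).relIndex Gk1 * Nat.card ↥(Y.map π)
      = (⁅Gk, Gk⁆ ⊔ ⨆ I ∈ 𝓘, I ⊓ Gk).relIndex Gk * Nat.card Y := by rw [hIk1, hIk]
    _ ≤ (⁅Gk, Gk⁆ ⊔ ⨆ I ∈ 𝓘, I ⊓ Gk).relIndex Gk * (Nat.card ↥(Y.map π) * p ^ r) := Nat.mul_le_mul_left _ hYle
    _ = (⁅Gk, Gk⁆ ⊔ ⨆ I ∈ 𝓘, I ⊓ Gk).relIndex Gk * p ^ r * Nat.card ↥(Y.map π) := by ring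

/-- The top layer: `[A : N_t P_t] = #(A/pA)` (`ν_t Y₀ = 0`; re-proved, the version of `Fukuda1994Thm1RankProofs` is private).
[cite: Washington1997, §13.3 Lemma 13.18] -/
private theorem relIndex_top_pow_eq_card_quotient' (hgA : Subgroup.zpowers g ⊓ A = ⊥) (hgen : A ⊔ Subgroup.zpowers g = ⊤) (hind : A.index = p ^ t)
    (h𝓘 : ∀ I ∈ 𝓘, I ⊓ A = ⊥ ∧ (I = ⊥ ∨ I ⊔ A = ⊤)) (hg𝓘 : Subgroup.zpowers g ∈ 𝓘)
    {Gt : Subgroup G} (hAGt : A ≤ Gt) (hGt : Gt.index = p ^ t) :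
    ((⁅Gt, Gt⁆ ⊔ ⨆ I ∈ 𝓘, I ⊓ Gt) ⊔ Subgroup.closure ((fun x : G => x ^ p) '' (Gt : Set G))).relIndex Gt =
      Nat.card (Additive A ⧸ (⊤ : Submodule ℤ (Additive A)).map ((p : ℤ) • (1 : Module.End ℤ (Additive A)))) := by
  have h := relIndex_commutator_sup_layer_pow_mul_card hgA hgen hind h𝓘 hg𝓘 le_rfl hAGt hGt
  rw [map_subOf_commutator_sup_index_eq_bot hgA hgen hind h𝓘 hg𝓘, bot_sup_eq] at h
  have hcardA : Nat.card A = Nat.card ↥((⊤ : Submodule ℤ (Additive A)).map ((p : ℤ) • (1 : Module.End ℤ (Additive A)))) *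
      Nat.card (Additive A ⧸ (⊤ : Submodule ℤ (Additive A)).map ((p : ℤ) • (1 : Module.End ℤ (Additive A)))) :=
    Submodule.card_eq_card_quotient_mul_card ((⊤ : Submodule ℤ (Additive A)).map ((p : ℤ) • (1 : Module.End ℤ (Additive A))))
  rw [hcardA, mul_comm (Nat.card ↥((⊤ : Submodule ℤ (Additive A)).map _))] at h
  exact Nat.eq_of_mul_eq_mul_right Nat.card_pos h

end Literature.NumberTheory.IwasawaTheory.FukudaGroup

/-! ## §3 The tower: `e_{n+k+1} ≤ e_{n+k} + r`, `λ ≤ B`, `λ ≤ r_n` under a certificate -/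

namespace Literature.NumberTheory.IwasawaTheory

open Literature.NumberTheory.EllipticCurves Literature.NumberTheory.NumberFields

variable {K : Type} [Field K] [NumberField K] {p : ℕ} [hp : Fact p.Prime]

/-- **One difference of `p`-class-number exponents is bounded by a rank bound.**  `κ` a `ℤ_p`-extension with `TotallyRamifiedFrom κ n₀`, `n ≥ n₀`;
`rank_p Cl(K_{n+k+1}) ≤ r ≤ p^{k₀}` and `k ≥ k₀ + 1`.  Then **`e_{n+k+1} ≤ e_{n+k} + r`** (`e_m = ord_p h(K_m)`).  From the package `exists_layer_package` at top
`t = k + 1` and the brick `FukudaGroup.relIndex_layer_succ_le_mul_pow`. [cite: Fukuda1994, Thm. 1 (2), p. 264 (proof)] [cite: Washington1997, §13.3 Lemma 13.18, Prop. 13.23] -/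
theorem classNumberPExp_succ_le_add_of_classGroupPRank_le (κ : ZpExtension K p) {n₀ n : ℕ} (hκ : TotallyRamifiedFrom κ n₀) (hn : n₀ ≤ n)
    {r k₀ k : ℕ} (hk : k₀ + 1 ≤ k) (hrk₀ : r ≤ p ^ k₀) (hr : classGroupPRank κ (n + (k + 1)) ≤ r) :
    classNumberPExp κ (n + (k + 1)) ≤ classNumberPExp κ (n + k) + r := by
  classical
  have hp0 : 0 < p := hp.out.pos
  obtain ⟨G, _instG, _instF, A', hA'n, _instC, g, 𝓘, hgA, hgen, hA'index, h𝓘, hg𝓘, hA'card, hlayer⟩ :=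
    exists_layer_package κ hκ hn (k + 1) (by omega)
  have hA'pg : ∃ a : ℕ, Nat.card A' = p ^ a := ⟨_, hA'card⟩
  obtain ⟨Gk, hAGk, hGk, hek, -⟩ := hlayer k (by omega)
  obtain ⟨Gt, hAGt, hGt, het, hrt⟩ := hlayer (k + 1) le_rfl
  -- `#(A'/pA') = p^{r_{n+k+1}} ≤ p^r`
  have hquot := FukudaGroup.relIndex_top_pow_eq_card_quotient' hgA hgen hA'index h𝓘 hg𝓘 hAGt hGt
  rw [hrt] at hquot
  have hrle : Nat.card (Additive A' ⧸ (⊤ : Submodule ℤ (Additive A')).map ((p : ℤ) • (1 : Module.End ℤ (Additive A')))) ≤ p ^ r := by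
    rw [← hquot]; exact Nat.pow_le_pow_right hp0 hr
  have h := FukudaGroup.relIndex_layer_succ_le_mul_pow hgA hgen hA'index h𝓘 hg𝓘 hA'pg hrle hrk₀ hk le_rfl hAGk hGk hAGt hGt
  rw [hek, het, ← pow_add] at h
  exact (Nat.pow_le_pow_iff_right hp.out.one_lt).mp h

/-- **Eventually bounded ranks bound every late difference**: if `rank_p Cl(K_m) ≤ B` for all `m ≥ n` (`n ≥ n₀`), then `e_{m+1} ≤ e_m + B` for every `m ≥ n + B + 1`
(`k₀ = B`, `B ≤ p^B`). [cite: Fukuda1994, Thm. 1 (2), p. 264 (proof)] [cite: Washington1997, §13.3 Prop. 13.23] -/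
theorem classNumberPExp_succ_le_add_of_forall_classGroupPRank_le (κ : ZpExtension K p) {n₀ n : ℕ} (hκ : TotallyRamifiedFrom κ n₀) (hn : n₀ ≤ n)
    {B : ℕ} (hB : ∀ m, n ≤ m → classGroupPRank κ m ≤ B) {m : ℕ} (hm : n + B + 1 ≤ m) :
    classNumberPExp κ (m + 1) ≤ classNumberPExp κ m + B := by
  obtain ⟨k, rfl⟩ : ∃ k, m = n + k := ⟨m - n, by omega⟩
  have h := classNumberPExp_succ_le_add_of_classGroupPRank_le κ hκ hn (k₀ := B) (k := k) (r := B) (by omega)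
    (Nat.lt_pow_self hp.out.one_lt).le (hB (n + (k + 1)) (by omega))
  simpa [Nat.add_assoc] using h

/-- ★ **`λ ≤ B` from an eventual rank bound.**  `κ` with `TotallyRamifiedFrom κ n₀`, `n ≥ n₀`, and `rank_p Cl(K_m) ≤ B` for all `m ≥ n`.  Then `μ = 0` (the ranks are
bounded along the whole tower — finitely many layers below `n` —, tree `classicalMuVanishes_of_forall_classGroupPRank_le`) and **`classicalLambda κ ≤ B`**: under `μ = 0`
the differences `e_{m+1} − e_m` are eventually the constant `λ` (`classNumberPExp_succ_sub_eq_classicalLambda`), and they are `≤ B` for `m ≥ n + B + 1`.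
(Structure-theory reading: `λ = rank_{ℤ_p} X ≤ dim_{𝔽_p} X/pX =` the eventual `p`-rank.) [cite: Washington1997, §13.3 Prop. 13.23 and Thm. 13.13]
[cite: Fukuda1994, Thm. 1 (2), p. 264] [cite: Lang1990, Ch. 5 §1 Thm. 1.2] -/
theorem classicalLambda_le_of_forall_classGroupPRank_le (κ : ZpExtension K p) {n₀ n : ℕ} (hκ : TotallyRamifiedFrom κ n₀) (hn : n₀ ≤ n)
    {B : ℕ} (hB : ∀ m, n ≤ m → classGroupPRank κ m ≤ B) :
    ClassicalMuVanishes κ ∧ classicalLambda κ ≤ B := by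
  classical
  -- ranks bounded everywhere
  have hB' : ∀ m, classGroupPRank κ m ≤ (range n).sup (classGroupPRank κ) ⊔ B := by
    intro m
    rcases lt_or_ge m n with hm | hm
    · exact le_sup_of_le_left (Finset.le_sup (f := classGroupPRank κ) (mem_range.mpr hm))
    · exact le_sup_of_le_right (hB m hm)
  have hμ : ClassicalMuVanishes κ := classicalMuVanishes_of_forall_classGroupPRank_le κ hB'
  refine ⟨hμ, ?_⟩
  obtain ⟨n₁, hn₁⟩ := classNumberPExp_succ_sub_eq_classicalLambda κ hμ
  set m := max n₁ (n + B + 1) with hmdef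
  have hdiff := hn₁ m (le_max_left _ _)
  have hle := classNumberPExp_succ_le_add_of_forall_classGroupPRank_le κ hκ hn hB (m := m) (le_max_right _ _)
  have hcast : (classicalLambda κ : ℤ) ≤ B := by
    rw [← hdiff]
    have : (classNumberPExp κ (m + 1) : ℤ) ≤ (classNumberPExp κ m : ℤ) + B := by exact_mod_cast hle
    linarith
  exact_mod_cast hcast

/-- ★ **A Fukuda RANK certificate bounds `λ`: `rank_p Cl(K_{n+1}) = rank_p Cl(K_n)` with `n ≥ n₀` ⟹ `classicalLambda κ ≤ rank_p Cl(K_n)`** (and `μ = 0`).  The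
certificate freezes the rank from layer `n` on (Fukuda 1994 Thm. 1 (2), tree-proved `fukuda1994_thm1_classGroupPRank_const_of_succ_eq_holds`), so
`classicalLambda_le_of_forall_classGroupPRank_le` applies with `B = r_n`.  E.g. a certificate of value `r` on a tower with `λ ≥ r` forced by genus theory pins `λ = r`.
[cite: Fukuda1994, Thm. 1 (2), p. 264] [cite: Washington1997, §13.3 Prop. 13.22–13.23 and Thm. 13.13] -/
theorem classicalLambda_le_of_classGroupPRank_succ_eq (κ : ZpExtension K p) {n₀ n : ℕ} (hκ : TotallyRamifiedFrom κ n₀) (hn : n₀ ≤ n)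
    (hr : classGroupPRank κ (n + 1) = classGroupPRank κ n) :
    ClassicalMuVanishes κ ∧ classicalLambda κ ≤ classGroupPRank κ n := by
  have hconst := (fukuda1994_thm1_classGroupPRank_const_of_succ_eq_holds K p κ n₀ hκ n hn hr).1
  exact classicalLambda_le_of_forall_classGroupPRank_le κ hκ hn fun m hm => (hconst m hm).le

/-- **The coinvariant door (L12 family) bounds `λ`**: `TotallyRamifiedFrom κ n₀`, `n ≥ n₀`, `c < p^i`, and at the pair `(n+i, n+i+1)` the subgroup
`Cl^p·⟨σx·x⁻¹ : σ fixing K_{n+i}⟩` of `Cl(K_{n+i+1})` has index `≤ p^c` ⟹ `rank_p Cl(K_{n+k}) ≤ c` for all `k` (tree) ⟹ **`classicalLambda κ ≤ c`** (and `μ = 0`).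
[cite: Washington1997, §13.3 Prop. 13.22–13.23 and Thm. 13.13] [cite: Fukuda1994, Thm. 1 (proof, p. 264)] -/
theorem classicalLambda_le_of_coinvariant_index_le (κ : ZpExtension K p) {n₀ n : ℕ} (hκ : TotallyRamifiedFrom κ n₀) (hn : n₀ ≤ n)
    {i c : ℕ} (hc : c < p ^ i)
    (hco : ((powMonoidHom p : ClassGroup (𝓞 (κ.layer (n + (i + 1)))) →* ClassGroup (𝓞 (κ.layer (n + (i + 1))))).range ⊔
        Subgroup.closure {x | ∃ (σ : (κ.layer (n + (i + 1))) ≃ₐ[K] (κ.layer (n + (i + 1))))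
          (_ : ∀ y : κ.layer (n + (i + 1)), ((y : κ.layer (n + (i + 1))) : AlgebraicClosure K) ∈ κ.layer (n + i) → σ y = y)
          (x' : ClassGroup (𝓞 (κ.layer (n + (i + 1))))), x = ClassGroup.mulEquiv (AmbiguousClass.intAut σ) x' * x'⁻¹}).index ≤ p ^ c) :
    ClassicalMuVanishes κ ∧ classicalLambda κ ≤ c :=
  classicalLambda_le_of_forall_classGroupPRank_le κ hκ hn fun m hm => by
    obtain ⟨k, rfl⟩ : ∃ k, m = n + k := ⟨m - n, by omega⟩
    exact classGroupPRank_le_of_coinvariant_index_le κ hκ hn hc hco k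

/-- **A certificate of the minimal possible value pins `λ`.**  If `μ = 0` forces `l₀ ≤ classicalLambda κ` (e.g. genus theory along the tower: unbounded growth
`e_m ≥ l₀·m − O(1)`) and a Fukuda certificate `r_{n+1} = r_n` (`n ≥ n₀`) has value `r_n = l₀`, then **`classicalLambda κ = l₀`** (`l₀ ≤ λ ≤ r_n`).
[cite: Fukuda1994, Thm. 1 (2), p. 264] [cite: Washington1997, §13.3 Thm. 13.13] -/
theorem classicalLambda_eq_of_classGroupPRank_succ_eq_of_le (κ : ZpExtension K p) {n₀ n : ℕ} (hκ : TotallyRamifiedFrom κ n₀) (hn : n₀ ≤ n)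
    (hr : classGroupPRank κ (n + 1) = classGroupPRank κ n) {l₀ : ℕ} (hl₀ : ClassicalMuVanishes κ → l₀ ≤ classicalLambda κ)
    (heq : classGroupPRank κ n = l₀) : classicalLambda κ = l₀ := by
  obtain ⟨hμ, hle⟩ := classicalLambda_le_of_classGroupPRank_succ_eq κ hκ hn hr
  have := hl₀ hμ
  omega

/-! ## §4 `λ ≤ rank_p Cl(K_m)` for all large `m` — every `ℤ_p`-extension, no hypothesis -/

/-- **Under `μ = 0` with ranks `≤ B`: `λ ≤ rank_p Cl(K_m)` for EVERY `m ≥ n₀ + B`** (`n₀` a Fukuda index).  The ranks are non-decreasing above `n₀`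
(`Fukuda.classGroupPRank_mono`) and bounded, so two consecutive layers `m' ≤ m'+1` with `n₀ ≤ m' ≤ n₀ + B` have equal rank
(`Fukuda.exists_classGroupPRank_succ_eq_of_forall_le`); the certificate bound gives `λ ≤ r_{m'} ≤ r_m`. [cite: Fukuda1994, Thm. 1 (2), p. 264]
[cite: Washington1997, §13.3 Prop. 13.22–13.23 and Thm. 13.13] -/
theorem classicalLambda_le_classGroupPRank_of_forall_le (κ : ZpExtension K p) {n₀ : ℕ} (hκ : TotallyRamifiedFrom κ n₀)
    {B : ℕ} (hB : ∀ m, classGroupPRank κ m ≤ B) {m : ℕ} (hm : n₀ + B ≤ m) : classicalLambda κ ≤ classGroupPRank κ m := by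
  obtain ⟨m', hm'₀, hm'B, heq⟩ := Fukuda.exists_classGroupPRank_succ_eq_of_forall_le κ hκ hB
  exact (classicalLambda_le_of_classGroupPRank_succ_eq κ hκ hm'₀ heq).2.trans (Fukuda.classGroupPRank_mono κ hκ hm'₀ (by omega))

/-- ★ **`λ ≤ rank_p Cl(K_m)` for all sufficiently large `m` — for EVERY `ℤ_p`-extension `κ` of every number field, with no hypothesis.**  If `μ = 0`
(`ClassicalMuVanishes κ`): the ranks are bounded (tree `exists_forall_classGroupPRank_le_of_classicalMuVanishes`), a Fukuda index exists
(`exists_totallyRamifiedFrom`), and `classicalLambda_le_classGroupPRank_of_forall_le` applies; if `μ ≠ 0`, `classicalLambda κ = 0` (junk value) and the bound is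
trivial.  Structure-theory reading: `λ = rk_{ℤ_p} X ≤ dim_{𝔽_p} X/pX = lim_m rank_p A_m`. [cite: Washington1997, §13.3 Thm. 13.13 and Prop. 13.23]
[cite: Lang1990, Ch. 5 §1 Thm. 1.2] [cite: Fukuda1994, Thm. 1 (2), p. 264] -/
theorem exists_forall_classicalLambda_le_classGroupPRank (κ : ZpExtension K p) :
    ∃ m₀ : ℕ, ∀ m, m₀ ≤ m → classicalLambda κ ≤ classGroupPRank κ m := by
  by_cases hμ : ClassicalMuVanishes κ
  · obtain ⟨n₀, hn₀⟩ := exists_totallyRamifiedFrom κ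
    obtain ⟨B, hB⟩ := exists_forall_classGroupPRank_le_of_classicalMuVanishes κ hμ
    exact ⟨n₀ + B, fun m hm => classicalLambda_le_classGroupPRank_of_forall_le κ hn₀ hB hm⟩
  · exact ⟨0, fun m _ => by rw [classicalLambda_eq_zero_of_not_classicalMuVanishes κ hμ]; exact Nat.zero_le _⟩

/-- **`μ = 0` and `λ ≥ l₀ ⟹ rank_p Cl(K_m) ≥ l₀` for all large `m`** (contrapositive reading for censuses: a tower whose `λ` is forced `≥ l₀` by genus theory has
all its deep `p`-ranks `≥ l₀`). [cite: Washington1997, §13.3 Thm. 13.13] [cite: Fukuda1994, Thm. 1 (2), p. 264] -/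
theorem exists_forall_le_classGroupPRank_of_le_classicalLambda (κ : ZpExtension K p) {l₀ : ℕ} (hl₀ : l₀ ≤ classicalLambda κ) :
    ∃ m₀ : ℕ, ∀ m, m₀ ≤ m → l₀ ≤ classGroupPRank κ m := by
  obtain ⟨m₀, h⟩ := exists_forall_classicalLambda_le_classGroupPRank κ
  exact ⟨m₀, fun m hm => hl₀.trans (h m hm)⟩

end Literature.NumberTheory.IwasawaTheory

end
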